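import Summits.CriticalPhenomena.PercolationContinuityZ3.Theorems.Transplant.FKConnectivityAllQPat3KNetPlaceTri
import HarnessLib

/-!
# Connectivity correlation inequalities for `φ_{w,q}`, every `q > 0` — THEOREM SP(𝒦): the two TRIANGLE-type leaves

Helper file (`--supports stmt-CriticalPhenomena-4575`), census lineage (gen 41) of LANE 2's FK sub-programme; builds on p205010 (kernel
theorem, internal audit signed; external expert review pending).  No definitions, no named facts, no sorries; standard axioms.

Two of the twelve K-state leaf specs of THEOREM SP(𝒦)'s inner bridge branches (census g41 drafts/README), as instances of the generic
TRIANGLE placement lemma «Pat3KNetPlaceTri» `FK.placeK_tri`: `FK.spGoodC_bridgeLeaf_tri` (type I: `b ∈ E₂ = Q_xy`, `s ∈ Q_xc`, `t ∈ Q_yc`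
— triangle `x y c`) and `FK.spGoodC_bridgeLeaf_tri3` (pc: `b ∈ Q_cd`, `s ∈ Q_xc`, `t ∈ Q_xd` — triangle `x c d`).
[cite: AyyerLinussonRavichandran2025, §7 (p. 22)]
-/

namespace Summit.CriticalPhenomena.PercolationContinuityZ3.Theorems

namespace FK

open scoped Classical

variable {V : Type*} [Fintype V] {N₀ : Finset (Sym2 V)} {Qac Qad Qbc Qbd Qcd E₂ E C : Finset (Sym2 V)} {x y c d b s t : V}

/-- **LEAF `tri` (type I)**: marks in the slots of the triangle `x y c`. [cite: AyyerLinussonRavichandran2025, §7 (p. 22)] -/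
theorem spGoodC_bridgeLeaf_tri
    (ihSP : ∀ {N' E' C' : Finset (Sym2 V)} {x' y' b' s' t' : V}, N'.card < N₀.card → IsKNet N' x' y' → E' ⊆ N' → C' ⊆ N' →
      (∃ e ∈ N', b' ∈ e) → (∃ e ∈ N', s' ∈ e) → (∃ e ∈ N', t' ∈ e) → b' ≠ s' → b' ≠ t' → s' ≠ t' → SPGoodC E' C' b' s' t')
    (hac : IsKNet Qac x c) (had : IsKNet Qad x d) (hbc : IsKNet Qbc y c) (hbd : IsKNet Qbd y d) (hcd : IsKNet Qcd c d)
    (hsep : BridgeSep Qac Qad Qbc Qbd Qcd x y c d) (h₂ : IsKNet E₂ x y) (hd : Disjoint (Qac ∪ Qad ∪ Qbc ∪ Qbd ∪ Qcd) E₂) (hN : Qac ∪ Qad ∪ Qbc ∪ Qbd ∪ Qcd ∪ E₂ ⊆ N₀)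
    (hV : ∀ z : V, (∃ e ∈ Qac ∪ Qad ∪ Qbc ∪ Qbd ∪ Qcd, z ∈ e) → (∃ e ∈ E₂, z ∈ e) → z = x ∨ z = y)
    (hE : E ⊆ Qac ∪ Qad ∪ Qbc ∪ Qbd ∪ Qcd ∪ E₂) (hC : C ⊆ Qac ∪ Qad ∪ Qbc ∪ Qbd ∪ Qcd ∪ E₂)
    (hs : ∃ e ∈ Qac, s ∈ e) (hsx : s ≠ x) (hsc : s ≠ c) (ht : ∃ e ∈ Qbc, t ∈ e) (hty : t ≠ y) (htc : t ≠ c)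
    (hb : ∃ e ∈ E₂, b ∈ e) (hbx : b ≠ x) (hby : b ≠ y) : SPGoodC E C b s t := by
  have K := k4Sep_of_bridge_par hac had hbc hbd hsep hd hV
  have eN : Qac ∪ Qad ∪ Qbc ∪ Qbd ∪ Qcd ∪ E₂ = E₂ ∪ (Qac ∪ Qad ∪ Qbc ∪ Qbd ∪ Qcd) := by ac_rfl
  rw [eN] at hN hE hC
  exact (placeK_tri ihSP K h₂ hac had hbc hbd hcd hN hb hbx hby ht hty htc hs hsx hsc hE hC).swap23

/-- **LEAF `tri3` (pc)**: marks in the slots of the triangle `x c d`. [cite: AyyerLinussonRavichandran2025, §7 (p. 22)] -/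
theorem spGoodC_bridgeLeaf_tri3
    (ihSP : ∀ {N' E' C' : Finset (Sym2 V)} {x' y' b' s' t' : V}, N'.card < N₀.card → IsKNet N' x' y' → E' ⊆ N' → C' ⊆ N' →
      (∃ e ∈ N', b' ∈ e) → (∃ e ∈ N', s' ∈ e) → (∃ e ∈ N', t' ∈ e) → b' ≠ s' → b' ≠ t' → s' ≠ t' → SPGoodC E' C' b' s' t')
    (hac : IsKNet Qac x c) (had : IsKNet Qad x d) (hbc : IsKNet Qbc y c) (hbd : IsKNet Qbd y d) (hcd : IsKNet Qcd c d)
    (hsep : BridgeSep Qac Qad Qbc Qbd Qcd x y c d) (h₂ : IsKNet E₂ x y) (hd : Disjoint (Qac ∪ Qad ∪ Qbc ∪ Qbd ∪ Qcd) E₂) (hN : Qac ∪ Qad ∪ Qbc ∪ Qbd ∪ Qcd ∪ E₂ ⊆ N₀)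
    (hV : ∀ z : V, (∃ e ∈ Qac ∪ Qad ∪ Qbc ∪ Qbd ∪ Qcd, z ∈ e) → (∃ e ∈ E₂, z ∈ e) → z = x ∨ z = y)
    (hE : E ⊆ Qac ∪ Qad ∪ Qbc ∪ Qbd ∪ Qcd ∪ E₂) (hC : C ⊆ Qac ∪ Qad ∪ Qbc ∪ Qbd ∪ Qcd ∪ E₂)
    (hb : ∃ e ∈ Qcd, b ∈ e) (hbc' : b ≠ c) (hbd' : b ≠ d) (hs : ∃ e ∈ Qac, s ∈ e) (hsx : s ≠ x) (hsc : s ≠ c)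
    (ht : ∃ e ∈ Qad, t ∈ e) (htx : t ≠ x) (htd : t ≠ d) : SPGoodC E C b s t := by
  have K := (k4Sep_of_bridge_par hac had hbc hbd hsep hd hV).swap_bc.swap_cd
  have eN : Qac ∪ Qad ∪ Qbc ∪ Qbd ∪ Qcd ∪ E₂ = Qac ∪ (Qad ∪ E₂ ∪ Qcd ∪ Qbc ∪ Qbd) := by ac_rfl
  rw [eN] at hN hE hC
  exact (placeK_tri ihSP K hac had h₂ hcd hbc.symm hbd.symm hN hs hsx hsc hb hbc' hbd' ht htx htd hE hC).swap12

end FK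

end Summit.CriticalPhenomena.PercolationContinuityZ3.Theorems
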